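import Summits.RiemannHypothesis.RiemannHypothesis.Theorems.SemilocalArchMajorantCentred
import HarnessLib

/-!
# Semi-local thresholds, negative side, at ANY finite set of primes (IIIb): the PIECEWISE certificate `WeilNegCertP`

Cell `rh-explicit` (HOME `run/shared/lean/pub/rh-explicit/`), seat cc-s2-4 gen7 (A4 SEMILOCAL-TABLE, the Lean side).  Honest
framing: theorems about the tree's `weilSemilocalThreshold S`; nothing here bears on RH.  No data is trusted.

`WeilNegCertP` = the data of `WeilNegCertS` (`SemilocalNegCertAtoms.lean`: odd polynomial witness `p`, window `b`,
enclosure orders, rational atom list, `logSuccLo`) plus the CUTS `T₁ < … < T_r = 2b` of the bulk `(0, 2b]`, CLAIMED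
rational bounds `B_i` of the piece integrals `∫_{(T_i,T_{i+1}]} w·D` (centred majorant of
`SemilocalArchMajorantCentred.lean`, valid up to `2b ≤ 4`) and a CLAIMED bound `A` of the atom side.  Verification is
SPLIT into independent kernel facts — `checkPiece c i = true` (one per piece), `checkAtoms c = true`, and
`checkMain c c₀ = true` (side conditions, `b ≤ 2`, and the final strict inequality
`A + Σ B_i + 2N·T < (c₀ + 2 Σ wlo)·N + 2m²`) — so that no single `decide` exceeds the kernel's per-declaration budget
(`HOME/cc-s2-4/CC4-LEAN.md` §8: one declaration dies at ≈ 60–75 s of kernel work).  SOUNDNESS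
(`weilSemilocalThreshold_le_of_checkP`):
`AtomsEnclose S N c.atoms c.logSuccLo → c₀ ≤ C_∅ → checkMain → checkAtoms → (∀ i < r, checkPiece i) → a*(S) ≤ c.b`.
Folklore throughout.
-/

set_option autoImplicit false
set_option linter.dupNamespace false  -- the mandated namespace repeats `RiemannHypothesis`

noncomputable section

open Complex Filter Set MeasureTheory Topology
open scoped Real

namespace Summit.RiemannHypothesis.RiemannHypothesis.Theorems.SemilocalPolyWitness

open MeasureTheory Set Finset Real
open Literature.NumberTheory.LFunctions
open Summit.RiemannHypothesis.RiemannHypothesis.Theorems.MotivicDoor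
open Summit.RiemannHypothesis.RiemannHypothesis.Theorems.MotivicDoor.SemilocalThreshold
open Summit.RiemannHypothesis.RiemannHypothesis.Theorems.MotivicDoor.SemilocalMarkov
open LQ

/-! ## The certificate `WeilNegCertP` -/

/-- A piecewise negative certificate: `WeilNegCertS` data plus the cuts of `(0, 2b]`, claimed rational bounds of the
piece integrals and of the atom side (each verified by its own kernel fact). -/
structure WeilNegCertP where
  /-- coefficients (in powers of `x`) of the odd polynomial `p`; the witness is `p·1_{[−b,b]}` -/
  p : List ℚ
  /-- the window half-width (`a*(S) ≤ b` is the conclusion) -/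
  b : ℚ
  /-- order of the `exp` majorant (`≥ 1`) -/
  nA : ℕ
  /-- half the number of geometric terms in each piece's majorant -/
  mA : ℕ
  /-- order of the `sinh` minorant -/
  KA : ℕ
  /-- number of explicit tail exponentials -/
  Kt : ℕ
  /-- order of the partial `exp` sums bounding `e^{−x}` (`≥ 1`) -/
  nt : ℕ
  /-- order of the Maclaurin polynomial in the polar moment (`≥ 1`) -/
  ne : ℕ
  /-- the atoms `(n, lo, hi, wlo, whi)` -/
  atoms : List (ℕ × AtomQ)
  /-- a rational lower bound of `log (N+1)` -/
  logSuccLo : ℚ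
  /-- the cuts `T₁ < … < T_r = 2b` of the bulk `(0, 2b]` -/
  cuts : List ℚ
  /-- claimed bounds `B_i ≥ ∫_{(T_i, T_{i+1}]} w·D` -/
  pieceB : List ℚ
  /-- claimed bound `A ≥ Σ_atoms whi·U` -/
  atomB : ℚ

namespace WeilNegCertP

variable (c : WeilNegCertP)

/-- `q = D/t` as a list. -/
def q : List ℚ := (incrementL c.p c.b).tail

/-- Kernel fact `i`: the `i`-th piece integral is at most the claimed `B_i`. -/
def checkPiece (i : ℕ) : Bool :=
  decide (pieceQ c.nA c.mA c.KA c.q ((0 :: c.cuts).getD i 0) (c.cuts.getD i 0) ≤ c.pieceB.getD i 0)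

/-- Kernel fact: the atom side is at most the claimed `A`. -/
def checkAtoms : Bool := decide (atomLhsQ (incrementL c.p c.b) c.atoms ≤ c.atomB)

/-- Lower bound of the right side, given `c₀ ≤ C_∅`. -/
def rhsQ (c0 : ℚ) : ℚ := (c0 + 2 * atomWloSum c.atoms) * LQ.normSq c.p c.b + 2 * mellinOneLowerQ c.p c.b c.ne ^ 2

/-- Kernel fact: side conditions and the final strict inequality from the CLAIMED bounds. -/
def checkMain (c0 : ℚ) : Bool :=
  isOddList c.p && decide (0 < c.b) && decide (c.b ≤ 2) &&
    decide (0 < c.nA) && decide (0 < c.nt) && decide (0 < c.ne) &&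
    decide ((incrementL c.p c.b).headD 0 = 0) && decide (invPartialExpQ c.nt (2 * (2 * c.b)) < 1) &&
    atomsOk (2 * c.b) c.atoms && decide (2 * c.b < c.logSuccLo) &&
    cutsOk 0 c.cuts && decide (lastCut 0 c.cuts = 2 * c.b) && decide (c.pieceB.length = c.cuts.length) &&
    decide (c.atomB + sumQ c.pieceB + 2 * LQ.normSq c.p c.b * archTailQ (2 * c.b) c.Kt c.nt < c.rhsQ c0)

end WeilNegCertP

/-- **SOUNDNESS of `WeilNegCertP`.** -/
theorem weilSemilocalThreshold_le_of_checkP (c : WeilNegCertP) {S : Finset ℕ} {N : ℕ} {c0 : ℚ}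
    (henc : AtomsEnclose S N c.atoms c.logSuccLo) (hc0 : (c0 : ℝ) ≤ semilocalEmptyConstant)
    (hmain : c.checkMain c0 = true) (hat : c.checkAtoms = true)
    (hpieces : ∀ i, i < c.cuts.length → c.checkPiece i = true) :
    weilSemilocalThreshold S ≤ (c.b : ℝ) := by
  simp only [WeilNegCertP.checkMain, Bool.and_eq_true, decide_eq_true_eq] at hmain
  obtain ⟨⟨⟨⟨⟨⟨⟨⟨⟨⟨⟨⟨⟨hodd, hb0⟩, hb2⟩, hnA⟩, hnt⟩, hne⟩, hhead⟩, htail1⟩, hatoms⟩, hsucc⟩, hcuts⟩, hlast⟩,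
    hlen⟩, hfinal⟩ := hmain
  simp only [WeilNegCertP.checkAtoms, decide_eq_true_eq] at hat
  simp only [WeilNegCertP.checkPiece, decide_eq_true_eq] at hpieces
  rw [atomsOk_iff] at hatoms
  obtain ⟨hnodup, hsub, hcover, hencl, hlogSucc⟩ := henc
  set p := c.p
  set b := c.b
  have hb0' : (0 : ℝ) < b := by exact_mod_cast hb0
  have hbwin : (b : ℝ) < Real.log ((N : ℝ) + 1) / 2 := by
    have h1 : ((2 * b : ℚ) : ℝ) < c.logSuccLo := by exact_mod_cast hsucc
    push_cast at h1
    linarith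
  set G := polyWitness p b with hG
  have hW := isMarkovWitness_polyWitness (p := p) (b := b) hodd hb0
  set inc := incrementL p b
  set Nm : ℝ := (LQ.normSq p b : ℝ)
  have hN : ∫ x, ‖G x‖ ^ 2 = Nm := integral_norm_sq_polyWitness (p := p) hb0
  have hN0 : 0 ≤ Nm := by rw [← hN]; exact integral_nonneg fun x ↦ by positivity
  -- D on (0, 2b]
  have hDev : ∀ t ∈ Set.Ioc (0 : ℝ) ((2 * b : ℚ) : ℝ), weilIncrement G t = ev inc t := fun t ht ↦
    weilIncrement_polyWitness_eq_ev hodd hb0 ht.1.le (by push_cast at ht; exact ht.2)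
  have hDq : ∀ t ∈ Set.Ioc (0 : ℝ) ((2 * b : ℚ) : ℝ), weilIncrement G t = t * ev c.q t := fun t ht ↦ by
    rw [hDev t ht, ev_eq_headD_add_tail, hhead]
    push_cast
    rw [zero_add]
    rfl
  have hq : ∀ t ∈ Set.Ioc (0 : ℝ) ((2 * b : ℚ) : ℝ), 0 ≤ ev c.q t := fun t ht ↦ by
    have h1 := weilIncrement_nonneg G t
    rw [hDq t ht] at h1
    exact (mul_nonneg_iff_of_pos_left ht.1).1 h1
  -- atoms
  have hAt : semilocalAtomEnergy S N G ≤ (c.atomB : ℝ) := by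
    unfold semilocalAtomEnergy
    rw [sum_range_eq_atoms_sum (h := fun n ↦ weilSemilocalCoeff S n * weilIncrement G (Real.log n)) hnodup hsub
      (fun n hn hnot ↦ by rw [hcover n hn hnot, zero_mul])]
    refine (atoms_sum_le_atomLhsQ inc c.atoms (fun na hna ↦ (hencl na hna).2.2.2) (fun na hna ↦ ?_)).trans
      (by exact_mod_cast hat)
    obtain ⟨hlo0, _, hhiT⟩ := hatoms na hna
    obtain ⟨hlo, hhi, _, _⟩ := hencl na hna
    have hmem : Real.log na.1 ∈ Set.Ioc (0 : ℝ) ((2 * b : ℚ) : ℝ) :=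
      ⟨lt_of_lt_of_le (by exact_mod_cast hlo0) hlo, hhi.trans (by exact_mod_cast hhiT)⟩
    refine ⟨weilIncrement_nonneg G _, ?_⟩
    rw [hDev _ hmem]
    exact ev_le_evalUpperQ inc hlo (by push_cast; linarith)
  -- bulk over the pieces
  have hlastR : ((lastCut 0 c.cuts : ℚ) : ℝ) = ((2 * b : ℚ) : ℝ) := by rw [hlast]
  have h4 : ((lastCut 0 c.cuts : ℚ) : ℝ) ≤ 4 := by
    rw [hlastR]; push_cast
    have : (b : ℝ) ≤ 2 := by exact_mod_cast hb2
    linarith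
  have hbulk := pieces_bound c.nA c.mA c.KA hnA (q := c.q) (D := weilIncrement G) 0 c.cuts c.pieceB le_rfl hcuts
    h4 hlen (fun t ht ↦ hDq t (by rw [hlastR] at ht; exact_mod_cast ht))
    (fun t ht ↦ hq t (by rw [hlastR] at ht; exact_mod_cast ht)) hpieces
  rw [hlastR] at hbulk
  push_cast at hbulk
  obtain ⟨hintA, hA⟩ := hbulk
  have hintA' : IntegrableOn (fun t ↦ weilArchDensity t * weilIncrement G t) (Set.Ioc (0 : ℝ) ((2 * b : ℚ) : ℝ)) := by
    push_cast; exact hintA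
  -- tail
  have h2b0 : (0 : ℚ) < 2 * b := by positivity
  obtain ⟨hintW, _⟩ := setIntegral_Ioi_weilArchDensity_le c.Kt (c := ((2 * b : ℚ) : ℝ)) (by exact_mod_cast h2b0)
  have hT := setIntegral_Ioi_weilArchDensity_le_archTailQ c.Kt hnt h2b0 htail1
  have hDtail : EqOn (fun t ↦ weilArchDensity t * weilIncrement G t) (fun t ↦ 2 * Nm * weilArchDensity t)
      (Set.Ioi ((2 * b : ℚ) : ℝ)) := fun t ht ↦ by
    simp only
    rw [weilIncrement_polyWitness_eq_of_lt hodd hb0 (by push_cast at ht; exact ht)]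
    ring
  have hintW' : IntegrableOn (fun t ↦ 2 * Nm * weilArchDensity t) (Set.Ioi ((2 * b : ℚ) : ℝ)) :=
    hintW.const_mul (2 * Nm)
  have hintT : IntegrableOn (fun t ↦ weilArchDensity t * weilIncrement G t) (Set.Ioi ((2 * b : ℚ) : ℝ)) :=
    hintW'.congr_fun hDtail.symm measurableSet_Ioi
  have hTail : ∫ t in Set.Ioi ((2 * b : ℚ) : ℝ), weilArchDensity t * weilIncrement G t ≤
      2 * Nm * archTailQ (2 * b) c.Kt c.nt := by
    rw [setIntegral_congr_fun measurableSet_Ioi hDtail, integral_const_mul]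
    exact mul_le_mul_of_nonneg_left hT (by positivity)
  -- the whole half-line
  have hunion : Set.Ioc (0 : ℝ) ((2 * b : ℚ) : ℝ) ∪ Set.Ioi ((2 * b : ℚ) : ℝ) = Set.Ioi (0 : ℝ) :=
    Set.Ioc_union_Ioi_eq_Ioi (by exact_mod_cast h2b0.le)
  have hfin : IntegrableOn (fun t ↦ weilArchDensity t * weilIncrement G t) (Set.Ioi (0 : ℝ)) := by
    rw [← hunion]; exact hintA'.union hintT
  have hInt : ∫ t in Set.Ioi (0 : ℝ), weilArchDensity t * weilIncrement G t
      ≤ (sumQ c.pieceB : ℝ) + 2 * Nm * archTailQ (2 * b) c.Kt c.nt := by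
    rw [← hunion, setIntegral_union Ioc_disjoint_Ioi_same measurableSet_Ioi hintA' hintT]
    refine add_le_add ?_ hTail
    push_cast; exact hA
  -- the polar moment
  have hm := mellinOneLowerQ_le_norm (p := p) hne hb0 (by exact_mod_cast hb2)
  have hm0 : (0 : ℝ) ≤ mellinOneLowerQ p b c.ne := by rw [mellinOneLowerQ]; push_cast; exact le_max_right _ _
  have hpol : (mellinOneLowerQ p b c.ne : ℝ) ^ 2 ≤ ‖weilMellin G 1‖ ^ 2 := pow_le_pow_left₀ hm0 hm 2
  -- the constant
  have hCS : (c0 : ℝ) + 2 * atomWloSum c.atoms ≤ semilocalWindowConstant S N := by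
    unfold semilocalWindowConstant semilocalCoeffSum
    rw [sum_range_eq_atoms_sum (h := fun n ↦ weilSemilocalCoeff S n) hnodup hsub hcover]
    have hw := atomWloSum_le c.atoms (fun na hna ↦ (hencl na hna).2.2.1)
    linarith
  -- assemble
  have hfinal' : ((c.atomB + sumQ c.pieceB + 2 * LQ.normSq p b * archTailQ (2 * b) c.Kt c.nt : ℚ) : ℝ) <
      c.rhsQ c0 := by exact_mod_cast hfinal
  push_cast at hfinal'
  have hrhs : (c.rhsQ c0 : ℝ) ≤ semilocalWindowConstant S N * (∫ x, ‖G x‖ ^ 2) + 2 * ‖weilMellin G 1‖ ^ 2 := by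
    rw [WeilNegCertP.rhsQ, hN]; push_cast
    have : ((c0 : ℝ) + 2 * atomWloSum c.atoms) * Nm ≤ semilocalWindowConstant S N * Nm :=
      mul_le_mul_of_nonneg_right hCS hN0
    linarith
  have hlt : semilocalAtomEnergy S N G + (∫ t in Set.Ioi (0 : ℝ), weilArchDensity t * weilIncrement G t) <
      semilocalWindowConstant S N * (∫ x, ‖G x‖ ^ 2) + 2 * ‖weilMellin G 1‖ ^ 2 := by
    linarith
  exact weilSemilocalThreshold_le_of_markovWitness_window S N hW hfin hlt hbwin

/-- Soundness with the sharp constant `c0SharpQ`. -/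
theorem weilSemilocalThreshold_le_of_checkP_sharp (c : WeilNegCertP) {S : Finset ℕ} {N : ℕ}
    (henc : AtomsEnclose S N c.atoms c.logSuccLo) (hmain : c.checkMain c0SharpQ = true)
    (hat : c.checkAtoms = true) (hpieces : ∀ i, i < c.cuts.length → c.checkPiece i = true) :
    weilSemilocalThreshold S ≤ (c.b : ℝ) :=
  weilSemilocalThreshold_le_of_checkP c henc c0SharpQ_le hmain hat hpieces

end Summit.RiemannHypothesis.RiemannHypothesis.Theorems.SemilocalPolyWitness

end
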